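import Literature.AlgebraicGeometry.Resolution.ArtinApproximationAffine
import Literature.AlgebraicGeometry.Resolution.SmoothPointEtaleFactorisation
import HarnessLib

/-!
# Artin approximation over étale neighbourhoods, affine form, from Popescu's theorem alone

Topic: `Literature/AlgebraicGeometry/Resolution`. `ArtinApproximationAffine.lean` proves the
ring-theoretic heart of M. Artin's approximation theorem over étale neighbourhoods (Artin 1969,
Cor. 2.1 = `Artin1969EtaleApproximation`; Stacks 07QZ over an affine base) from TWO named facts:
Popescu's General Néron desingularisation (`Popescu1986_generalNeronDesingularization`, Stacks
07GC) and the étale lifting lemma Stacks 07M7 (`Stacks07M7_etaleLift`). This file removes the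
second: the proof of 07QZ uses 07M7 only at the point `𝔭` (an étale `B → B'`, a prime `𝔭'` over
`𝔭` with `κ(𝔭) = κ(𝔭')`, and *some* `B`-algebra map from Popescu's smooth algebra `C` to `B'`),
and this pointwise form is the PROVED theorem `exists_etale_factorisation_of_smooth`
(`SmoothPointEtaleFactorisation.lean`): the `κ(𝔭)`-valued point `C → R^ → κ(𝔭)` of the smooth
`B`-algebra `C` factors through an étale `B`-algebra `B'`, `C → B' → κ(𝔭)`, and
`𝔭' = ker (B' → κ(𝔭))`.

* `comap_eq_of_algHom_residueField`, `exists_sub_mem_maximalIdeal_of_algHom_residueField`,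
  `exists_fraction_residueField` — the prime `𝔭' = ker ψ` of a `B`-algebra map
  `ψ : B' → κ(𝔭)` lies over `𝔭` and has trivial residue extension (in the form used for stalks
  of schemes: every element of a localisation `R'` of `B'` at `𝔭'` is congruent mod `𝔪_{R'}` to
  the image of an element of `R = B_𝔭`); `κ(𝔭)` consists of fractions of elements of `B`.
* `exists_etale_solution_of_popescu` — **Stacks 07QZ, affine form, from Popescu's theorem
  alone** (same statement as `exists_etale_solution_of_isRegularHom`, without the hypothesis
  `Stacks07M7_etaleLift`); `exists_etale_solution_of_isGRing_of_popescu` — the same for a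
  G-ring `B` (e.g. of finite type over a field).

[cite: StacksProject, Tag 07QZ]; [cite: Artin1969, Cor. 2.1, p. 27]
-/

noncomputable section

open IsLocalRing TensorProduct

namespace Literature.AlgebraicGeometry.Resolution

universe u

/-! ## The residue field at the kernel of a `κ(𝔭)`-valued point -/

section Residue

/-- If `ψ : B' → κ(𝔭)` is a `B`-algebra map (`R = B_𝔭`, `κ(𝔭) = R/𝔪_R`) and `𝔭' = ker ψ`,
then `𝔭'` lies over `𝔭`. [folklore] -/
theorem comap_eq_of_algHom_residueField {B B' R : Type u} [CommRing B] [CommRing B'] [CommRing R]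
    (p : Ideal B) [p.IsPrime] [Algebra B R] [IsLocalRing R] [IsLocalization.AtPrime R p]
    [Algebra B B'] (ψ : B' →ₐ[B] ResidueField R) (p' : Ideal B') (hker : ∀ x, ψ x = 0 ↔ x ∈ p') :
    p'.comap (algebraMap B B') = p := by
  ext x
  rw [Ideal.mem_comap, ← hker, ψ.commutes, IsScalarTower.algebraMap_apply B R (ResidueField R),
    ResidueField.algebraMap_eq, residue_eq_zero_iff]
  exact IsLocalization.AtPrime.to_map_mem_maximal_iff R p x

/-- **Trivial residue extension at the kernel of a `κ(𝔭)`-valued point.** If `ψ : B' → κ(𝔭)`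
is a `B`-algebra map and `𝔭' = ker ψ`, then for every localisation `R'` of `B'` at `𝔭'` and
every ring map `φ : R = B_𝔭 → R'` compatible with `B → B'`, every element of `R'` is congruent
modulo `𝔪_{R'}` to an element of `φ(R)` (i.e. `κ(𝔭) → κ(𝔭')` is onto). [folklore] -/
theorem exists_sub_mem_maximalIdeal_of_algHom_residueField {B B' R R' : Type u} [CommRing B]
    [CommRing B'] [CommRing R] [CommRing R'] (p : Ideal B) [p.IsPrime] [Algebra B R]
    [IsLocalRing R] [IsLocalization.AtPrime R p] [Algebra B B'] (ψ : B' →ₐ[B] ResidueField R)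
    (p' : Ideal B') [p'.IsPrime] (hker : ∀ x, ψ x = 0 ↔ x ∈ p')
    [Algebra B' R'] [IsLocalRing R'] [IsLocalization.AtPrime R' p']
    (φ : R →+* R') (hφ : φ.comp (algebraMap B R) = (algebraMap B' R').comp (algebraMap B B'))
    (x : R') : ∃ r : R, x - φ r ∈ maximalIdeal R' := by
  -- `ψ` extends to `ψ' : R' → κ(𝔭)`
  have hunit : ∀ u : p'.primeCompl, IsUnit (ψ.toRingHom u) := fun u =>
    Ne.isUnit fun h => u.2 ((hker u).mp h)
  let ψ' : R' →+* ResidueField R := IsLocalization.lift (M := p'.primeCompl) hunit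
  have hψ' : ∀ b' : B', ψ' (algebraMap B' R' b') = ψ b' := fun b' =>
    IsLocalization.lift_eq (M := p'.primeCompl) hunit b'
  -- `ψ' ∘ φ` is the residue map of `R`
  have hcomp : ψ'.comp φ = residue R := by
    refine IsLocalization.ringHom_ext p.primeCompl (S := R) ?_
    ext b
    change ψ' (φ (algebraMap B R b)) = residue R (algebraMap B R b)
    rw [map_algebraMap_eq_of_comp_eq φ hφ b, hψ', ψ.commutes,
      IsScalarTower.algebraMap_apply B R (ResidueField R), ResidueField.algebraMap_eq]
  obtain ⟨r, hr⟩ := residue_surjective (ψ' x)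
  refine ⟨r, IsLocalRing.le_maximalIdeal (RingHom.ker_ne_top ψ') ?_⟩
  rw [RingHom.mem_ker, map_sub, sub_eq_zero, ← hr]
  exact (congrArg (fun g : R →+* ResidueField R => g r) hcomp).symm

/-- Every element of `κ(𝔭) = R/𝔪_R` (`R = B_𝔭`) is a fraction `a/s` of images of elements of
`B` with `s ∉ 𝔭`. [folklore] -/
theorem exists_fraction_residueField {B R : Type u} [CommRing B] [CommRing R] (p : Ideal B)
    [p.IsPrime] [Algebra B R] [IsLocalRing R] [IsLocalization.AtPrime R p]
    (x : ResidueField R) :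
    ∃ a s : B, algebraMap B (ResidueField R) s ≠ 0 ∧
      algebraMap B (ResidueField R) s * x = algebraMap B (ResidueField R) a := by
  obtain ⟨r, rfl⟩ := residue_surjective x
  obtain ⟨⟨a, s⟩, rfl⟩ := IsLocalization.mk'_surjective p.primeCompl r
  refine ⟨a, s, ?_, ?_⟩
  · rw [IsScalarTower.algebraMap_apply B R (ResidueField R), ResidueField.algebraMap_eq, Ne,
      residue_eq_zero_iff]
    exact fun h => (mem_nonunits_iff.mp ((IsLocalRing.mem_maximalIdeal _).mp h))
      (IsLocalization.map_units R s)
  · rw [IsScalarTower.algebraMap_apply B R (ResidueField R),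
      IsScalarTower.algebraMap_apply B R (ResidueField R), ResidueField.algebraMap_eq, ← map_mul,
      IsLocalization.mk'_spec' R a s]

end Residue

/-! ## The affine theorem from Popescu's theorem alone -/

section Main

variable {B : Type u} [CommRing B] [IsNoetherianRing B] (p : Ideal B) [p.IsPrime]
  (R : Type u) [CommRing R] [IsLocalRing R] [Algebra B R] [IsLocalization.AtPrime R p]

/-- **Artin approximation over étale neighbourhoods, affine form, from Popescu's theorem**
(Artin 1969, Cor. 2.1; Stacks 07QZ over a non-local base). Let `B` be a Noetherian ring, `𝔭` a
prime, `R` a localisation of `B` at `𝔭` such that `B → R^` is a regular homomorphism,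
`F_j ∈ B[Y_i]` finitely many polynomials in finitely many variables, `ȳ` a solution of `F = 0`
in `R^` and `N ≥ 0`. Then there are an étale `B`-algebra `B'`, a prime `𝔭'` of `B'` over `𝔭`,
and a solution `y` of `F = 0` in `B'` such that, for every localisation `R'` of `B'` at `𝔭'`
and every ring map `φ : R → R'` compatible with `B → B'`: (1) every element of `R'` is
congruent mod `𝔪_{R'}` to an element of `φ(R)`, and (2) `yᵢ ≡ φ(a) (mod 𝔪_{R'}^N)` whenever
`ȳᵢ ≡ a (mod 𝔪_R^N)`. PROVED from `Popescu1986_generalNeronDesingularization` alone (Stacks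
07QZ: enlarge the system so that solvability forces the congruence; Popescu factors the point
`B[Y, Z]/J → R^` through a smooth `C`; the point `C → R^ → κ(𝔭)` factors through an étale `B'`
by `exists_etale_factorisation_of_smooth`). [cite: StacksProject, Tag 07QZ] -/
theorem exists_etale_solution_of_popescu
    (hP : Popescu1986_generalNeronDesingularization.{u})
    (hreg : IsRegularHom B (AdicCompletion (maximalIdeal R) R))
    {ι κ : Type} [Finite ι] [Finite κ] (F : κ → MvPolynomial ι B)
    (ybar : ι → AdicCompletion (maximalIdeal R) R)
    (hF : ∀ j, MvPolynomial.aeval ybar (F j) = 0) (N : ℕ) :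
    ∃ (B' : Type u) (_ : CommRing B') (_ : Algebra B B') (p' : Ideal B') (_ : p'.IsPrime)
      (y : ι → B'),
      Algebra.Etale B B' ∧ p'.comap (algebraMap B B') = p ∧
      (∀ j, MvPolynomial.aeval y (F j) = 0) ∧
      ∀ (R' : Type u) [CommRing R'] [IsLocalRing R'] [Algebra B' R'] [IsLocalization.AtPrime R' p']
        (φ : R →+* R'), φ.comp (algebraMap B R) = (algebraMap B' R').comp (algebraMap B B') →
        (∀ x : R', ∃ r : R, x - φ r ∈ maximalIdeal R') ∧
        ∀ (i : ι) (a : R),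
          AdicCompletion.evalₐ (maximalIdeal R) N (ybar i) = Ideal.Quotient.mk _ a →
            algebraMap B' R' (y i) - φ a ∈ maximalIdeal R' ^ N := by
  classical
  haveI : IsNoetherianRing R := IsLocalization.isNoetherianRing p.primeCompl R inferInstance
  haveI : IsNoetherianRing (AdicCompletion (maximalIdeal R) R) :=
    isNoetherianRing_adicCompletion_maximalIdeal R
  obtain ⟨a, b, t, M, d, z, ha, ht, hab, hd, hz⟩ := exists_approximation_data p R ybar N
  -- the enlarged system `F(Y) = 0`, `tᵢ Yᵢ - bᵢ - Σ_l d_l Z_{il} = 0` over `B`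
  let σ : Type := ι ⊕ (ι × Fin M)
  let G : ι → MvPolynomial σ B := fun i =>
    MvPolynomial.C (t i) * MvPolynomial.X (Sum.inl i) - MvPolynomial.C (b i) -
      ∑ l, MvPolynomial.C (d l) * MvPolynomial.X (Sum.inr (i, l))
  let F' : κ → MvPolynomial σ B := fun j => MvPolynomial.rename Sum.inl (F j)
  let J : Ideal (MvPolynomial σ B) := Ideal.span (Set.range F' ∪ Set.range G)
  -- its solution `(ȳ, z)` in `R^`
  let ω : σ → AdicCompletion (maximalIdeal R) R := Sum.elim ybar fun il => z il.1 il.2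
  have hωF : ∀ j, MvPolynomial.aeval ω (F' j) = 0 := fun j => by
    change MvPolynomial.aeval ω (MvPolynomial.rename Sum.inl (F j)) = 0
    rw [MvPolynomial.aeval_rename]
    exact hF j
  have hωG : ∀ i, MvPolynomial.aeval ω (G i) = 0 := fun i => by
    change MvPolynomial.aeval ω (MvPolynomial.C (t i) * MvPolynomial.X (Sum.inl i) -
      MvPolynomial.C (b i) - ∑ l, MvPolynomial.C (d l) * MvPolynomial.X (Sum.inr (i, l))) = 0
    simp only [map_sub, map_mul, map_sum, MvPolynomial.aeval_C, MvPolynomial.aeval_X]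
    change algebraMap B _ (t i) * ybar i - algebraMap B _ (b i) -
      ∑ l, algebraMap B _ (d l) * z i l = 0
    rw [hz i, sub_self]
  have hJ : ∀ g ∈ J, MvPolynomial.aeval ω g = 0 := by
    have hle : J ≤ RingHom.ker (MvPolynomial.aeval ω).toRingHom := by
      change Ideal.span _ ≤ _
      rw [Ideal.span_le]
      rintro _ (⟨j, rfl⟩ | ⟨i, rfl⟩)
      · exact hωF j
      · exact hωG i
    exact fun g hg => hle hg
  let f : (MvPolynomial σ B ⧸ J) →ₐ[B] AdicCompletion (maximalIdeal R) R :=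
    Ideal.Quotient.liftₐ J (MvPolynomial.aeval ω) hJ
  -- Popescu: the point factors through a smooth `B`-algebra `C`
  obtain ⟨C, _, _, hC, v, w, -⟩ :=
    hP B (AdicCompletion (maximalIdeal R) R) inferInstance inferInstance hreg
      (MvPolynomial σ B ⧸ J) inferInstance f
  haveI : Algebra.Smooth B C := hC
  -- the `κ(𝔭)`-valued point of `C` factors through an étale `B`-algebra `B'`
  let χ : C →ₐ[B] ResidueField R :=
    ((AdicCompletion.evalOneₐ (maximalIdeal R)).restrictScalars B).comp w
  obtain ⟨B', _, _, hEt, τ, ψ, -⟩ :=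
    exists_etale_factorisation_of_smooth (exists_fraction_residueField p (R := R)) χ
  let p' : Ideal B' := RingHom.ker ψ
  haveI hp' : p'.IsPrime := RingHom.ker_isPrime ψ
  have hker : ∀ x, ψ x = 0 ↔ x ∈ p' := fun x => (RingHom.mem_ker (f := ψ)).symm
  have hp'B : p'.comap (algebraMap B B') = p := comap_eq_of_algHom_residueField p ψ p' hker
  -- the solution: images of the variables under `B[Y, Z] → A → C → B'`
  let Φ : MvPolynomial σ B →ₐ[B] B' := τ.comp (v.comp (Ideal.Quotient.mkₐ B J))
  have hΦJ : ∀ g ∈ J, Φ g = 0 := fun g hg => by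
    change τ (v (Ideal.Quotient.mkₐ B J g)) = 0
    rw [Ideal.Quotient.mkₐ_eq_mk, Ideal.Quotient.eq_zero_iff_mem.mpr hg, map_zero, map_zero]
  have hΦ : ∀ g, Φ g = MvPolynomial.aeval (fun v => Φ (MvPolynomial.X v)) g := fun g =>
    congrArg (fun ψ : MvPolynomial σ B →ₐ[B] B' => ψ g) (MvPolynomial.aeval_unique Φ)
  let y : ι → B' := fun i => Φ (MvPolynomial.X (Sum.inl i))
  let wz : ι × Fin M → B' := fun il => Φ (MvPolynomial.X (Sum.inr il))
  have hyw : (fun v : σ => Φ (MvPolynomial.X v)) = Sum.elim y wz := by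
    ext v
    rcases v with i | il <;> rfl
  have hyF : ∀ j, MvPolynomial.aeval y (F j) = 0 := fun j => by
    have h := hΦJ (F' j) (Ideal.subset_span (Or.inl ⟨j, rfl⟩))
    rw [hΦ, hyw] at h
    change MvPolynomial.aeval (Sum.elim y wz) (MvPolynomial.rename Sum.inl (F j)) = 0 at h
    rw [MvPolynomial.aeval_rename, Sum.elim_comp_inl] at h
    exact h
  have hyG : ∀ i, algebraMap B B' (t i) * y i - algebraMap B B' (b i) =
      ∑ l, algebraMap B B' (d l) * wz (i, l) := fun i => by
    have h := hΦJ (G i) (Ideal.subset_span (Or.inr ⟨i, rfl⟩))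
    rw [hΦ, hyw] at h
    change MvPolynomial.aeval (Sum.elim y wz) (MvPolynomial.C (t i) * MvPolynomial.X (Sum.inl i) -
      MvPolynomial.C (b i) - ∑ l, MvPolynomial.C (d l) * MvPolynomial.X (Sum.inr (i, l))) = 0 at h
    simp only [map_sub, map_mul, map_sum, MvPolynomial.aeval_C, MvPolynomial.aeval_X,
      Sum.elim_inl, Sum.elim_inr] at h
    exact sub_eq_zero.mp h
  refine ⟨B', inferInstance, inferInstance, p', hp', y, hEt, hp'B, hyF, ?_⟩
  intro R' _ _ _ _ φ hφ
  refine ⟨fun x => exists_sub_mem_maximalIdeal_of_algHom_residueField p ψ p' hker φ hφ x,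
    fun i a₂ ha₂ => ?_⟩
  have ha₂' : a₂ - a i ∈ maximalIdeal R ^ N := by
    rw [← Ideal.Quotient.eq, ← ha₂, ha i]
  exact sub_mem_maximalIdeal_pow_of_eq_sum p p' hp'B φ hφ (ht i) (hab i) hd (hyG i) ha₂'

/-- **Artin approximation over étale neighbourhoods, affine form, for G-rings, from Popescu's
theorem**: as `exists_etale_solution_of_popescu`, the regularity of `B → R^` being supplied by
the G-ring property of `B` (`IsGRing.isRegularHom_comp_completion`; e.g. `B` of finite type over
a field, `Matsumura1987_32_6_cor`). [cite: StacksProject, Tag 07QZ] -/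
theorem exists_etale_solution_of_isGRing_of_popescu
    (hP : Popescu1986_generalNeronDesingularization.{u}) (hB : IsGRing B)
    {ι κ : Type} [Finite ι] [Finite κ] (F : κ → MvPolynomial ι B)
    (ybar : ι → AdicCompletion (maximalIdeal R) R)
    (hF : ∀ j, MvPolynomial.aeval ybar (F j) = 0) (N : ℕ) :
    ∃ (B' : Type u) (_ : CommRing B') (_ : Algebra B B') (p' : Ideal B') (_ : p'.IsPrime)
      (y : ι → B'),
      Algebra.Etale B B' ∧ p'.comap (algebraMap B B') = p ∧
      (∀ j, MvPolynomial.aeval y (F j) = 0) ∧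
      ∀ (R' : Type u) [CommRing R'] [IsLocalRing R'] [Algebra B' R'] [IsLocalization.AtPrime R' p']
        (φ : R →+* R'), φ.comp (algebraMap B R) = (algebraMap B' R').comp (algebraMap B B') →
        (∀ x : R', ∃ r : R, x - φ r ∈ maximalIdeal R') ∧
        ∀ (i : ι) (a : R),
          AdicCompletion.evalₐ (maximalIdeal R) N (ybar i) = Ideal.Quotient.mk _ a →
            algebraMap B' R' (y i) - φ a ∈ maximalIdeal R' ^ N :=
  exists_etale_solution_of_popescu p R hP (IsGRing.isRegularHom_comp_completion hB p R) F ybar hF N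

end Main

end Literature.AlgebraicGeometry.Resolution

end
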